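import Mathlib

/-!
# Bicoloured frame cycles of a host (crux `HyperoctahedralThreshold`, stmt-MatrixMultiplication-10883)

Setting of the refutation line `refutation-local-symmetry` (skeleton
`Cruxes/HyperoctahedralThreshold/Lines/refutation_local_symmetry.lean`): three fixed-point-free involutions `μ c` of
`Fin n` ("colours" = three perfect matchings).  The frame `M₀ ∪ M₁` of the first two colours is a disjoint union of
even cycles alternating the two colours; this file sets up that cycle structure in the walk language of the line
(no definitions): the ALTERNATING WALK `X (t + 1) = μ (e t) (X t)` from a vertex, along the colour sequence
`e t = t % 2` (kept abstract through `(e t).val = t % 2`), has a least positive return time `T ≤ n`, `T` is even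
(an odd return would put a fixed point of a colour in the middle, `ThinWalk.ne_odd`), `T` is a period, the walk
visits pairwise distinct points in every time window of length `T` (`ThinWalk.eq_iff`, `ThinWalk.ne_of_window`),
its point set (the cycle, `T` points) is closed under both frame colours, and the cycle of a vertex off it is
disjoint from it, so the two least periods add up to at most `n` (`ThinWalk.period_add_le`).  Registered summary:
`stub_frameCycle`.  This is part 1/3 of the thin-walk lemma (G1) of crux NOTES §B (`stub_thinCleanWalk`,
Theorems/…ThinCleanWalk.lean; siege variation "double counting on the colour classes" = the two parity classes of a
frame cycle).  Pure finite combinatorics. [this line; folklore]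
-/

set_option linter.dupNamespace false

namespace Summit.MatrixMultiplication.MatrixMultiplication.Theorems.HyperoctahedralThreshold

open Equiv

namespace ThinWalk

variable {n : ℕ}

/-! ### The alternating colour sequence `e t = t % 2` (abstracted by its defining property) -/

/-- Consecutive alternating colours differ. -/
theorem e_ne_succ (e : ℕ → Fin 3) (he : ∀ t, (e t).val = t % 2) (t : ℕ) : e t ≠ e (t + 1) := by
  intro h
  have h' := congrArg Fin.val h
  rw [he, he] at h'
  omega

/-- Alternating colours only depend on the parity of the time. -/
theorem e_eq_of_mod (e : ℕ → Fin 3) (he : ∀ t, (e t).val = t % 2) {s t : ℕ} (h : s % 2 = t % 2) :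
    e s = e t :=
  Fin.ext (by rw [he, he, h])

/-- Alternating colours are never the third colour `2`. -/
theorem e_ne_two (e : ℕ → Fin 3) (he : ∀ t, (e t).val = t % 2) (t : ℕ) : e t ≠ 2 := by
  intro h
  have h' := congrArg Fin.val h
  rw [he] at h'
  have h2 : ((2 : Fin 3) : ℕ) = 2 := rfl
  omega

/-- A colour other than `2` is one of two consecutive alternating colours. -/
theorem eq_e_or (e : ℕ → Fin 3) (he : ∀ t, (e t).val = t % 2) (c : Fin 3) (hc : c ≠ 2) (t : ℕ) :
    c = e t ∨ c = e (t + 1) := by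
  have hcv : c.val ≠ 2 := fun h => hc (Fin.ext h)
  by_cases h0 : c.val = t % 2
  · exact Or.inl (Fin.ext (by rw [he]; exact h0))
  · right
    apply Fin.ext
    rw [he]
    have := c.isLt
    omega

/-! ### The alternating walk `X (t + 1) = μ (e t) (X t)` -/

section Walk

variable (μ : Fin 3 → Perm (Fin n)) (e : ℕ → Fin 3) (X : ℕ → Fin n)

/-- Each colour is an involution: `μ c (μ c x) = x`. -/
theorem mu_mu (hμ : ∀ c, μ c * μ c = 1) (c : Fin 3) (x : Fin n) : μ c (μ c x) = x := by
  have h : (μ c * μ c) x = x := by rw [hμ c]; rfl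
  simpa using h

/-- One step back along the walk. -/
theorem back (hμ : ∀ c, μ c * μ c = 1) (hX : ∀ t, X (t + 1) = μ (e t) (X t)) (t : ℕ) :
    μ (e t) (X (t + 1)) = X t := by
  rw [hX, mu_mu μ hμ]

/-- The walk never returns after an odd number of steps (it would produce a fixed point of a colour in the middle). -/
theorem ne_odd (hμ : ∀ c, μ c * μ c = 1) (hfpf : ∀ c v, μ c v ≠ v) (he : ∀ t, (e t).val = t % 2)
    (hX : ∀ t, X (t + 1) = μ (e t) (X t)) : ∀ d s : ℕ, X s ≠ X (s + 2 * d + 1) := by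
  intro d
  induction d with
  | zero =>
    intro s h
    rw [show s + 2 * 0 + 1 = s + 1 from by omega, hX] at h
    exact hfpf _ _ h.symm
  | succ d ih =>
    intro s h
    apply ih (s + 1)
    calc X (s + 1) = μ (e s) (X s) := hX s
      _ = μ (e (s + 1 + 2 * d + 1)) (X (s + 1 + 2 * d + 1 + 1)) := by
          rw [h, e_eq_of_mod e he (show s % 2 = (s + 1 + 2 * d + 1) % 2 by omega),
            show s + 2 * (d + 1) + 1 = s + 1 + 2 * d + 1 + 1 by omega]
      _ = X (s + 1 + 2 * d + 1) := back μ e X hμ hX _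

/-- A coincidence at even distance propagates forward. -/
theorem shift (he : ∀ t, (e t).val = t % 2) (hX : ∀ t, X (t + 1) = μ (e t) (X t)) {s d : ℕ}
    (h : X s = X (s + 2 * d)) : ∀ j, X (s + j) = X (s + 2 * d + j) := by
  intro j
  induction j with
  | zero => simpa using h
  | succ j ih =>
    rw [show s + (j + 1) = (s + j) + 1 by omega, show s + 2 * d + (j + 1) = (s + 2 * d + j) + 1 by omega,
      hX, hX, ih, e_eq_of_mod e he (show (s + j) % 2 = (s + 2 * d + j) % 2 by omega)]

/-- A coincidence at even distance propagates back to time `0`: the distance is a period. -/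
theorem period_of_eq (hμ : ∀ c, μ c * μ c = 1) (he : ∀ t, (e t).val = t % 2)
    (hX : ∀ t, X (t + 1) = μ (e t) (X t)) : ∀ {s d : ℕ}, X s = X (s + 2 * d) → X 0 = X (2 * d) := by
  intro s
  induction s with
  | zero => intro d h; simpa using h
  | succ s ih =>
    intro d h
    apply ih
    rw [← back μ e X hμ hX s, h, show s + 1 + 2 * d = (s + 2 * d) + 1 by omega,
      e_eq_of_mod e he (show s % 2 = (s + 2 * d) % 2 by omega), back μ e X hμ hX]

/-- The alternating walk from any vertex exists. -/
theorem exists_walk (u : Fin n) : ∃ Y : ℕ → Fin n, Y 0 = u ∧ ∀ t, Y (t + 1) = μ (e t) (Y t) :=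
  ⟨fun t => Nat.rec (motive := fun _ => Fin n) u (fun s y => μ (e s) y) t, rfl, fun _ => rfl⟩

/-- The walk returns to its start at some positive time `≤ n` (pigeonhole among `X 0, …, X n`). -/
theorem exists_period (hμ : ∀ c, μ c * μ c = 1) (hfpf : ∀ c v, μ c v ≠ v) (he : ∀ t, (e t).val = t % 2)
    (hX : ∀ t, X (t + 1) = μ (e t) (X t)) : ∃ T, 0 < T ∧ T ≤ n ∧ X T = X 0 := by
  have key : ∀ a b : ℕ, a < b → b ≤ n → X a = X b → ∃ T, 0 < T ∧ T ≤ n ∧ X T = X 0 := by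
    intro a b hab hb h
    obtain ⟨m, rfl⟩ : ∃ m, b = a + m := ⟨b - a, by omega⟩
    rcases Nat.even_or_odd m with ⟨d, rfl⟩ | ⟨d, rfl⟩
    · have h' : X a = X (a + 2 * d) := by rw [h, two_mul]
      exact ⟨2 * d, by omega, by omega, (period_of_eq μ e X hμ he hX h').symm⟩
    · exact absurd (by rw [show a + 2 * d + 1 = a + (2 * d + 1) by omega]; exact h)
        (ne_odd μ e X hμ hfpf he hX d a)
  obtain ⟨a, b, hab, h⟩ := Fintype.exists_ne_map_eq_of_card_lt (fun i : Fin (n + 1) => X i) (by simp)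
  have hne : (a : ℕ) ≠ b := Fin.val_ne_of_ne hab
  have hb := b.isLt
  have ha := a.isLt
  rcases Nat.lt_or_gt_of_ne hne with hlt | hlt
  · exact key a b hlt (by omega) h
  · exact key b a hlt (by omega) h.symm

end Walk

/-! ### The least period `T` and the cycle -/

section Period

variable (μ : Fin 3 → Perm (Fin n)) (e : ℕ → Fin 3) (X : ℕ → Fin n) (T : ℕ)

/-- The least period is even. -/
theorem T_even (hμ : ∀ c, μ c * μ c = 1) (hfpf : ∀ c v, μ c v ≠ v) (he : ∀ t, (e t).val = t % 2)
    (hX : ∀ t, X (t + 1) = μ (e t) (X t)) (hTX : X T = X 0) : T % 2 = 0 := by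
  by_contra hodd
  obtain ⟨d, hd⟩ : ∃ d, T = 2 * d + 1 := ⟨T / 2, by omega⟩
  exact ne_odd μ e X hμ hfpf he hX d 0 (by rw [show 0 + 2 * d + 1 = T by omega]; exact hTX.symm)

/-- `T` is a period of the walk. -/
theorem periodic (he : ∀ t, (e t).val = t % 2) (hX : ∀ t, X (t + 1) = μ (e t) (X t)) (hT2 : T % 2 = 0)
    (hTX : X T = X 0) (t : ℕ) : X (t + T) = X t := by
  have h := shift μ e X he hX (s := 0) (d := T / 2)
    (by rw [show 0 + 2 * (T / 2) = T by omega]; exact hTX.symm) t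
  rw [show 0 + t = t by omega, show 0 + 2 * (T / 2) + t = t + T by omega] at h
  exact h.symm

/-- Multiples of `T` are periods. -/
theorem periodic_mul (he : ∀ t, (e t).val = t % 2) (hX : ∀ t, X (t + 1) = μ (e t) (X t)) (hT2 : T % 2 = 0)
    (hTX : X T = X 0) : ∀ q t, X (t + q * T) = X t := by
  intro q
  induction q with
  | zero => intro t; simp
  | succ q ih =>
    intro t
    rw [show t + (q + 1) * T = (t + q * T) + T by ring, periodic μ e X T he hX hT2 hTX, ih]

/-- Reduction of the time modulo `T`. -/
theorem X_mod (he : ∀ t, (e t).val = t % 2) (hX : ∀ t, X (t + 1) = μ (e t) (X t)) (hT2 : T % 2 = 0)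
    (hTX : X T = X 0) (t : ℕ) : X (t % T) = X t := by
  conv_rhs => rw [← Nat.mod_add_div t T, show t % T + T * (t / T) = t % T + (t / T) * T by ring]
  exact (periodic_mul μ e X T he hX hT2 hTX (t / T) (t % T)).symm

/-- For the LEAST period: coincidences of the walk happen exactly at times congruent modulo `T`. -/
theorem mod_eq_of_eq (hμ : ∀ c, μ c * μ c = 1) (hfpf : ∀ c v, μ c v ≠ v) (he : ∀ t, (e t).val = t % 2)
    (hX : ∀ t, X (t + 1) = μ (e t) (X t)) (hT0 : 0 < T) (hTX : X T = X 0)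
    (hTmin : ∀ t, 0 < t → X t = X 0 → T ≤ t) {s t : ℕ} (h : X s = X t) : s % T = t % T := by
  have hT2 := T_even μ e X T hμ hfpf he hX hTX
  suffices key : ∀ a m : ℕ, X a = X (a + m) → a % T = (a + m) % T by
    rcases le_total s t with hst | hst
    · obtain ⟨m, rfl⟩ : ∃ m, t = s + m := ⟨t - s, by omega⟩
      exact key s m h
    · obtain ⟨m, rfl⟩ : ∃ m, s = t + m := ⟨s - t, by omega⟩
      exact (key t m h.symm).symm
  intro a m h
  rcases Nat.even_or_odd m with ⟨d, rfl⟩ | ⟨d, rfl⟩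
  · have h0 : X 0 = X (2 * d) := period_of_eq μ e X hμ he hX (s := a) (d := d) (by rw [h, two_mul])
    have hr : (2 * d) % T = 0 := by
      by_contra hr
      have h1 : X ((2 * d) % T) = X 0 := by rw [X_mod μ e X T he hX hT2 hTX, ← h0]
      exact absurd (hTmin _ (Nat.pos_of_ne_zero hr) h1) (not_le.2 (Nat.mod_lt _ hT0))
    rw [show a + (d + d) = a + 2 * d by omega, Nat.add_mod, hr, Nat.add_zero, Nat.mod_mod]
  · exact absurd (by rw [show a + 2 * d + 1 = a + (2 * d + 1) by omega]; exact h)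
      (ne_odd μ e X hμ hfpf he hX d a)

/-- Coincidence criterion for the least period. -/
theorem eq_iff (hμ : ∀ c, μ c * μ c = 1) (hfpf : ∀ c v, μ c v ≠ v) (he : ∀ t, (e t).val = t % 2)
    (hX : ∀ t, X (t + 1) = μ (e t) (X t)) (hT0 : 0 < T) (hTX : X T = X 0)
    (hTmin : ∀ t, 0 < t → X t = X 0 → T ≤ t) {s t : ℕ} : X s = X t ↔ s % T = t % T :=
  ⟨mod_eq_of_eq μ e X T hμ hfpf he hX hT0 hTX hTmin, fun h => by
    rw [← X_mod μ e X T he hX (T_even μ e X T hμ hfpf he hX hTX) hTX s, h,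
      X_mod μ e X T he hX (T_even μ e X T hμ hfpf he hX hTX) hTX t]⟩

/-- Two distinct times less than `T` apart carry distinct points. -/
theorem ne_of_window (hμ : ∀ c, μ c * μ c = 1) (hfpf : ∀ c v, μ c v ≠ v) (he : ∀ t, (e t).val = t % 2)
    (hX : ∀ t, X (t + 1) = μ (e t) (X t)) (hT0 : 0 < T) (hTX : X T = X 0)
    (hTmin : ∀ t, 0 < t → X t = X 0 → T ≤ t) :
    ∀ a b : ℕ, a ≠ b → a < b + T → b < a + T → X a ≠ X b := by
  suffices key : ∀ a m : ℕ, 0 < m → m < T → X a ≠ X (a + m) by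
    intro a b hab h1 h2 h
    rcases Nat.lt_or_gt_of_ne hab with hlt | hlt
    · obtain ⟨m, rfl⟩ : ∃ m, b = a + m := ⟨b - a, by omega⟩
      exact key a m (by omega) (by omega) h
    · obtain ⟨m, rfl⟩ : ∃ m, a = b + m := ⟨a - b, by omega⟩
      exact key b m (by omega) (by omega) h.symm
  intro a m hm hmT h
  have h1 := mod_eq_of_eq μ e X T hμ hfpf he hX hT0 hTX hTmin h
  have h2 : (a + m - a) % T = 0 := Nat.sub_mod_eq_zero_of_mod_eq h1.symm
  rw [Nat.add_sub_cancel_left, Nat.mod_eq_of_lt hmT] at h2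
  omega

/-- The cycle (`X '' [0, T)`) consists of all points of the walk. -/
theorem mem_cycle (he : ∀ t, (e t).val = t % 2) (hX : ∀ t, X (t + 1) = μ (e t) (X t)) (hT0 : 0 < T)
    (hT2 : T % 2 = 0) (hTX : X T = X 0) {w : Fin n} :
    w ∈ (Finset.range T).image X ↔ ∃ j, X j = w := by
  constructor
  · intro h
    obtain ⟨j, -, hj⟩ := Finset.mem_image.1 h
    exact ⟨j, hj⟩
  · rintro ⟨j, rfl⟩
    exact Finset.mem_image.2 ⟨j % T, Finset.mem_range.2 (Nat.mod_lt _ hT0), X_mod μ e X T he hX hT2 hTX j⟩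

/-- The cycle has exactly `T` points. -/
theorem card_cycle (hμ : ∀ c, μ c * μ c = 1) (hfpf : ∀ c v, μ c v ≠ v) (he : ∀ t, (e t).val = t % 2)
    (hX : ∀ t, X (t + 1) = μ (e t) (X t)) (hT0 : 0 < T) (hTX : X T = X 0)
    (hTmin : ∀ t, 0 < t → X t = X 0 → T ≤ t) : ((Finset.range T).image X).card = T := by
  rw [Finset.card_image_of_injOn, Finset.card_range]
  intro s hs t ht h
  have hs' : s < T := Finset.mem_range.1 (Finset.mem_coe.1 hs)
  have ht' : t < T := Finset.mem_range.1 (Finset.mem_coe.1 ht)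
  have := mod_eq_of_eq μ e X T hμ hfpf he hX hT0 hTX hTmin h
  rwa [Nat.mod_eq_of_lt hs', Nat.mod_eq_of_lt ht'] at this

/-- The cycle is closed under the two frame colours (every colour `≠ 2`). -/
theorem closed_cycle (hμ : ∀ c, μ c * μ c = 1) (he : ∀ t, (e t).val = t % 2)
    (hX : ∀ t, X (t + 1) = μ (e t) (X t)) (hT0 : 0 < T) (hT2 : T % 2 = 0) (hTX : X T = X 0) {w : Fin n}
    (hw : w ∈ (Finset.range T).image X) (c : Fin 3) (hc : c ≠ 2) : μ c w ∈ (Finset.range T).image X := by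
  rw [mem_cycle μ e X T he hX hT0 hT2 hTX] at hw ⊢
  obtain ⟨j, rfl⟩ := hw
  rcases eq_e_or e he c hc j with rfl | rfl
  · exact ⟨j + 1, hX j⟩
  · refine ⟨j + T - 1, ?_⟩
    have h1 : X j = X ((j + T - 1) + 1) := by
      rw [show j + T - 1 + 1 = j + T by omega, periodic μ e X T he hX hT2 hTX]
    rw [h1, e_eq_of_mod e he (show (j + 1) % 2 = (j + T - 1) % 2 by omega), back μ e X hμ hX]

/-- A second alternating walk starting off the cycle stays off the cycle. -/
theorem walk_avoids (hμ : ∀ c, μ c * μ c = 1) (he : ∀ t, (e t).val = t % 2)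
    (hX : ∀ t, X (t + 1) = μ (e t) (X t)) (hT0 : 0 < T) (hT2 : T % 2 = 0) (hTX : X T = X 0)
    (Y : ℕ → Fin n) (hY : ∀ t, Y (t + 1) = μ (e t) (Y t)) (h0 : Y 0 ∉ (Finset.range T).image X) :
    ∀ t, Y t ∉ (Finset.range T).image X := by
  intro t
  induction t with
  | zero => exact h0
  | succ t ih =>
    intro h
    apply ih
    have := closed_cycle μ e X T hμ he hX hT0 hT2 hTX h (e t) (e_ne_two e he t)
    rwa [back μ e Y hμ hY] at this

/-- Two disjoint cycles fit into the `n` points: their least periods add up to at most `n`. -/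
theorem period_add_le (hμ : ∀ c, μ c * μ c = 1) (hfpf : ∀ c v, μ c v ≠ v) (he : ∀ t, (e t).val = t % 2)
    (hX : ∀ t, X (t + 1) = μ (e t) (X t)) (hT0 : 0 < T) (hTX : X T = X 0)
    (hTmin : ∀ t, 0 < t → X t = X 0 → T ≤ t) (Y : ℕ → Fin n) (T' : ℕ) (hY : ∀ t, Y (t + 1) = μ (e t) (Y t))
    (hT0' : 0 < T') (hTX' : Y T' = Y 0) (hTmin' : ∀ t, 0 < t → Y t = Y 0 → T' ≤ t)
    (h0 : Y 0 ∉ (Finset.range T).image X) : T' + T ≤ n := by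
  have hT2 := T_even μ e X T hμ hfpf he hX hTX
  have hd : Disjoint ((Finset.range T').image Y) ((Finset.range T).image X) := by
    rw [Finset.disjoint_left]
    intro w hw hw'
    obtain ⟨j, -, rfl⟩ := Finset.mem_image.1 hw
    exact walk_avoids μ e X T hμ he hX hT0 hT2 hTX Y hY h0 j hw'
  have := Finset.card_le_univ ((Finset.range T').image Y ∪ (Finset.range T).image X)
  rwa [Finset.card_union_of_disjoint hd, card_cycle μ e Y T' hμ hfpf he hY hT0' hTX' hTmin',
    card_cycle μ e X T hμ hfpf he hX hT0 hTX hTmin, Fintype.card_fin] at this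

end Period

/-- The alternating walk from a vertex together with its LEAST positive return time (`≤ n`). -/
theorem exists_cycle (μ : Fin 3 → Perm (Fin n)) (e : ℕ → Fin 3) (hμ : ∀ c, μ c * μ c = 1)
    (hfpf : ∀ c v, μ c v ≠ v) (he : ∀ t, (e t).val = t % 2) (u : Fin n) :
    ∃ (X : ℕ → Fin n) (T : ℕ), X 0 = u ∧ (∀ t, X (t + 1) = μ (e t) (X t)) ∧ 0 < T ∧ T ≤ n ∧ X T = X 0 ∧
      ∀ t, 0 < t → X t = X 0 → T ≤ t := by
  classical
  obtain ⟨Y, hY0, hY⟩ := exists_walk μ e u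
  obtain ⟨T₁, h1, h2, h3⟩ := exists_period μ e Y hμ hfpf he hY
  have hex : ∃ t, 0 < t ∧ Y t = Y 0 := ⟨T₁, h1, h3⟩
  exact ⟨Y, Nat.find hex, hY0, hY, (Nat.find_spec hex).1, (Nat.find_min' hex ⟨h1, h3⟩).trans h2,
    (Nat.find_spec hex).2, fun t ht h => Nat.find_min' hex ⟨ht, h⟩⟩

end ThinWalk

open ThinWalk in
/-- **Registered form** (`stub_frameCycle`, a `--supports` helper of crux stmt-MatrixMultiplication-10883): the
bicoloured cycle through a vertex.  For three fixed-point-free involutions `μ c` of `Fin n` and the alternating colour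
sequence `e` (`(e t).val = t % 2`), the walk `X` from any vertex `u` with `X (t + 1) = μ (e t) (X t)` has a least
positive return time `T`, with `T ≤ n`, `T` even, and `X s = X t ↔ s ≡ t (mod T)`. [this line; folklore] -/
theorem stub_frameCycle : ∀ (n : ℕ) (μ : Fin 3 → Equiv.Perm (Fin n)), (∀ i, μ i * μ i = 1 ∧ ∀ v, μ i v ≠ v) → ∀ (e : ℕ → Fin 3), (∀ t, (e t).val = t % 2) → ∀ u : Fin n, ∃ (X : ℕ → Fin n) (T : ℕ), X 0 = u ∧ (∀ t, X (t + 1) = μ (e t) (X t)) ∧ 0 < T ∧ T ≤ n ∧ T % 2 = 0 ∧ X T = X 0 ∧ (∀ t, 0 < t → X t = X 0 → T ≤ t) ∧ (∀ s t : ℕ, X s = X t ↔ s % T = t % T) := by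
  intro n μ hμ e he u
  obtain ⟨X, T, hX0, hX, hT0, hTn, hTX, hTmin⟩ := exists_cycle μ e (fun c => (hμ c).1) (fun c => (hμ c).2) he u
  exact ⟨X, T, hX0, hX, hT0, hTn, T_even μ e X T (fun c => (hμ c).1) (fun c => (hμ c).2) he hX hTX, hTX, hTmin,
    fun s t => eq_iff μ e X T (fun c => (hμ c).1) (fun c => (hμ c).2) he hX hT0 hTX hTmin⟩

end Summit.MatrixMultiplication.MatrixMultiplication.Theorems.HyperoctahedralThreshold
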